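import Summits.QuantumFields.YangMills.Theorems.BalabanUVNodesN09AxialCovariance181OnDomainsReg8Nesting

/-!
# NODE N09 — FLAG №7′ «reg8 ROW UNSUPPLIABLE AT THE CONSUMED INSTANCE», LOCATED IN THE KERNEL: (S1) at EQUAL RADII the (8)-membership row `hreg8` IS the existence half
# of (1.1) read through `Node00.Uk_mem_bgReg` — door v1.2 minus `hreg8 ∕ hle ∕ hεreg`; (S2) the substance sits in the [B11]-rows: the inner∕outer invariant `2B₃ ≤ L²` of every
# plaquette-keyed domain and the EMPTY Theorem-1 radius window `[2B₃r∕L², a₀]` for once-averaged data at one radius `r = a₀` — and the TWO-RADII window print uses is inhabited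

TRACK A (YM-PLAN §2d, node N09 of 28), seat `pub-ymgap-dag-n09-w1` (D-0149 width seat 1∕4), generation g8 = director-ym №307 (2)(P1) ∕ R523 (a) «DESIGN MEMO door v1.3» pen; this file is the
memo's kernel companion (`HOME/pub-ymgap-dag-n09-w1/DESIGN-MEMO-door-v1.3.md` §3–§4).  Key of record K1⁹ `StabilityBRunRowsAtRecordR13SepCoPHV` = stmt-QuantumFields-27364 (`--supports … --as helper`,
count-neutral).  [I] = [Balaban1987RG1] (CMP 109), [B11] = [Balaban1985Variational] (CMP 102) (= «[15]» of [I]), [B7] = [Balaban1985Averaging] (CMP 98).  THEOREMS ONLY (0 `def`, 0 `sorry`).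

WHY.  Door v1.2 (dag-n09-w2 g2 `…N09AxialCovariance181OnDomainsReg8Nesting`, p601129) displays the (8)-membership row
`hreg8 : ∀ P k ≤ P.K, ∀ V ∈ domAltOfRecord θ.ν P.K k, Uk … k θ.εbg V ∈ bgReg … k θ.ν.εreg` next to [B11] Thm 1 ×3 at `θ.εbg` (`h11 ∕ hres ∕ huniq`).  dag-n24-c's N09T3 engine (p726416) consumes
the door at the Z3 Gauss pin, where `θ.ν.εreg = a₀ = θ.εbg` (`numerics7OfThm1CCM_εreg`, `theta13OfThm1CCMWZB_εbg`, both `rfl`) and `θ.ν.ε₀ := 2a₀∕L²`; ref-H READ-594 ∕ DEF-1 g29 located that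
this seat's g2 supplier road `…N09BackgroundRadiiReg8OfThm1Objects.hreg8_of_thm1Objects_of_ukRows` ([B11] Thm 1 (8) at `δ := ν.ε₀`, row `hB : B₃·ν.ε₀ ≤ ν.εreg`) cannot reach that instance
(`B₃ ≤ L²∕2` against K0's `2L² ≤ B₃`) — FLAG №7′ (director-ym №307).
* §1 (S1) ★ `hreg8_of_h11_of_εreg_eq`: whenever `ν.εreg = εbg` the row `hreg8` is `fun k hk V hV => Uk_mem_bgReg (h11 k hk V hV).1` — node00-def-B's «`U_k(V) ∈ U_k(ε₀)` on the solvable set»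
  ([I] (1.2)); `hreg8_row_of_h11_row` is the run-family form in the engine's reduced letters (row 1 of `hN09TF` from row 6).  The B₃-road is simply the wrong road at equal radii.
* §2 ★★ `thm3Member_forall_stage13SepCoPH_onDomains_of_axialOn_of_suppPt_of_radii_eq` — door v1.2 with `hreg8 ∕ hle ∕ hεreg` REPLACED by the one letter `hradii : θ.ν.εreg = θ.εbg` (`rfl` at
  the Z3 pin); `…_of_measurableUk` twin; `b12_main_…` corollary.  Available to the engine if the director wants №7′'s LETTER closed by name; the memo advises against booking it as the cure,
  because of §3.
* §3 (S2) LOCATED ARITHMETIC (pure real inequalities; nothing of the tree's objects): `two_B₃_le_Lsq_of_rows` — [B11] Thm 1 (8) on a plaquette domain (`B₃·δ ≤ εreg`), `εreg ≤ εbg` and the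
  nesting row `2εbg ≤ δ·L²` force `2B₃ ≤ L²` (DEF-1 g29's pointing invariant, value-free: every PLAQUETTE-keyed domain is dead); ★ `thm1Window_onceAveraged_empty_at_one_radius` — the data
  `Ū^{k−1}(U_k V)` of an `r`-regular minimiser are `2r∕L²`-regular ([B7] Prop. 2 (53), dag-n21-c `plaqSmall_iter_Uk_level`), so [B11] Thm 1's radius window for them is `[2B₃r∕L², a₀]`, EMPTY at
  `r = a₀ > 0` under `2L² ≤ B₃` — at one radius the rows `hres ∕ huniq` of the first averaged level are outside [B11] AS PRINTED whatever the domain; ★ `two_radii_window_inhabited` — with a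
  membership radius `ρ = a₀L²∕(2B₃)` below the uniqueness radius `εbg = a₀` and the outer threshold `ε₀ = a₀∕B₃`, all of `2B₃ρ ≤ a₀L²`, `ρ ≤ εbg ≤ a₀`, `2ρ ≤ ε₀L²`, `0 < ε₀ ≤ εbg` hold for
  every `B₃ ≥ 2L²`, `L ≥ 1` — print's regime ([I] p.260: `U_k(V) ∈ 𝔘_k(ε₀)` with «ε₀ sufficiently small»; p.265 (2.2)–(2.3)), the numeric shape of record for door v1.3 (memo §5).

HONEST FRAMING: count-neutral kernel bookkeeping + arithmetic BY NAME; NOTHING of Bałaban's asserted ([B11] Thm 1's clauses, (F7a), the axiality conventions stay DISPLAYED in §2 exactly as in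
door v1.2); §3 are statements about real numbers, not about the tree's objects; NO carrier re-pointed; FLAG №7′ NOT closed by this file (its substance is re-located, memo §4); N09 ∕ N24 ∕ N07
NOT discharged; K0⁷ ∕ K1⁹ ∕ K3⁸ NOT closed; counts unmoved (typed 28∕28 · discharged 8∕28); one finite four-torus programme at fixed ε — R4 closes the conditional rung `BalabanLadder.UV`
only; the Yang–Mills mass gap (Clay) is NOT proved by any of this; nothing continuum ∕ ℝ⁴ ∕ OS.  THEOREMS ONLY, standard axioms.
-/

noncomputable section

namespace Summit.QuantumFields.YangMills.BalabanUVNodes.N09Reg8RowAtEqualRadiiLocated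

open MeasureTheory
open Literature.MathematicalPhysics.QuantumFieldTheory.Balaban1983to89
open Literature.MathematicalPhysics.QuantumFieldTheory.Balaban1983to89.Node00
open ExpMeanLog (deltaSU)
open B12NodeKnitRecord8 (b12_main_of_leaf_of_thm3Member)
open DagBinding
open Summit.QuantumFields.YangMills.BalabanUVNodes.N09AxialCovariance181OnDomainsReg8Nesting
  (thm3Member_forall_stage13SepCoPH_onDomains_of_axialOn_of_reg8_of_suppPt thm3Member_forall_stage13SepCoPH_onDomains_of_axialOn_of_reg8_of_suppPt_of_measurableUk)

variable {F : T4Continuum.T4Family} {N : ℕ} [NeZero N]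

/-! ## §1. (S1) At equal radii the (8)-membership row is the existence half of (1.1) -/

/-- ★ **(S1) `hreg8` FROM `h11` AT EQUAL RADII**: if the cut-off radius and the background radius coincide (`ν.εreg = εbg` — the Z3 pin: both `a₀`), then for every small field `V` of the domains
the radius-`εbg` background of record is `ν.εreg`-regular for the trivial reason that the minimiser of record lies in its own class (`Node00.Uk_mem_bgReg`, [I] (1.2) first clause on the
solvable set) — no [B11] Thm 1 (8), no `B₃`.  [cite: Balaban1987RG1, (1.1)–(1.2) p.260 and (0.21) p.256] -/
theorem hreg8_of_h11_of_εreg_eq (ν : Stage7Numerics) (εbg : ℝ) (K : ℕ) (hradii : ν.εreg = εbg)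
    (h11 : ∀ k, k ≤ K → ∀ V ∈ domAltOfRecord F N ν K k, UkExists F N K k εbg V ∧ UniqueUkOrbit F N K k εbg V) :
    ∀ k, k ≤ K → ∀ V ∈ domAltOfRecord F N ν K k, Uk F N K k εbg V ∈ bgReg F N K k ν.εreg := by
  intro k hk V hV
  rw [hradii]
  exact Uk_mem_bgReg (h11 k hk V hV).1

/-- (S1), existence-only input: the uniqueness half of `h11` is not used. [cite: Balaban1987RG1, (1.2) p.260 (bookkeeping)] -/
theorem hreg8_of_ukExists_of_εreg_eq (ν : Stage7Numerics) (εbg : ℝ) (K : ℕ) (hradii : ν.εreg = εbg)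
    (hex : ∀ k, k ≤ K → ∀ V ∈ domAltOfRecord F N ν K k, UkExists F N K k εbg V) :
    ∀ k, k ≤ K → ∀ V ∈ domAltOfRecord F N ν K k, Uk F N K k εbg V ∈ bgReg F N K k ν.εreg := by
  intro k hk V hV
  rw [hradii]
  exact Uk_mem_bgReg (hex k hk V hV)

/-- **(S1) IN THE ENGINE'S REDUCED LETTERS**: row 1 of dag-n24-c's `hN09TF` (`Uk … k a₀ V ∈ bgReg … k a₀` on the domains of `ν`) from its row 6 (`UkExists … k a₀ V ∧ UniqueUkOrbit … k a₀ V`) — the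
displayed (8)-row at the Z3 pin is not an independent row. [cite: Balaban1987RG1, (1.2) p.260 (bookkeeping)] -/
theorem hreg8_row_of_h11_row (ν : Stage7Numerics) (a₀ : ℝ)
    (h11 : ∀ (P : B12.RunParams) (k : ℕ), k ≤ P.K → ∀ V ∈ domAltOfRecord F N ν P.K k, UkExists F N P.K k a₀ V ∧ UniqueUkOrbit F N P.K k a₀ V) :
    ∀ (P : B12.RunParams) (k : ℕ), k ≤ P.K → ∀ V ∈ domAltOfRecord F N ν P.K k, Uk F N P.K k a₀ V ∈ bgReg F N P.K k a₀ :=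
  fun P k hk V hV => Uk_mem_bgReg (h11 P k hk V hV).1

/-! ## §2. Door v1.2 at a record with `θ.ν.εreg = θ.εbg`: the rows `hreg8`, `hle`, `hεreg` are gone -/

/-- ★★ **DOOR v1.2 AT EQUAL RADII («v1.2-eq»)**: dag-n09-w2 g2's `thm3Member_forall_stage13SepCoPH_onDomains_of_axialOn_of_reg8_of_suppPt` with its binders `hreg8`, `hle : θ.ν.εreg ≤ θ.εbg`,
`hεreg : 0 ≤ θ.ν.εreg` REPLACED by the single letter `hradii : θ.ν.εreg = θ.εbg` (`rfl` at the Z3 Gauss pin): `hreg8 := §1`, `hle := hradii.le`, `hεreg := hradii ▸ hε.le`.  Displayed, verbatim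
from v1.2: `cd`, `haxDom`, `haxbg`, `hχregpt`, (I19) `hint`, [B11] ×3 at `θ.εbg` (`h11 ∕ hres ∕ huniq` — N07's slot; memo §4: at the Z3 pin these are OUTSIDE [B11] Thm 1's printed window),
`0 < θ.ε₂₉`, `0 < θ.εbg`, the three [B7]-numerics rows.  CONDITIONAL on every displayed hypothesis; nothing of Bałaban asserted; N09 NOT discharged; K1⁹ NOT closed.
[cite: Balaban1987RG1, Thm 3 p.264, (1.1)–(1.3) p.260, (2.1)–(2.3) p.265, (2.9)–(2.10) pp.266–267; Balaban1985Variational, Thm 1 (6), (8)–(10) p.279 and (181) p.307; Balaban1985Averaging, Prop. 2 (53) p.26] -/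
theorem thm3Member_forall_stage13SepCoPH_onDomains_of_axialOn_of_suppPt_of_radii_eq (θ : Stage13HParams F N) (h : θ.Provisos₁₃SepCoPH F N) {w : WorldP}
    (hC : w.C = (datumOfRecord₁₃SepCoPH F N θ h).C) (cd : (P : B12.RunParams) → (j : ℕ) → ContourData (F.P P.K) j (SU N))
    (hradii : θ.ν.εreg = θ.εbg)
    (haxDom : ∀ (P : B12.RunParams), ∀ j < P.K, ∀ W ∈ domAltOfRecord F N θ.ν P.K (j + 1), AxialGauge (cd P j) (critCfgOfRecord F N θ.ν P.K j W))
    (haxbg : ∀ (P : B12.RunParams) (k : ℕ), k ≤ P.K → ∀ V ∈ domAltOfRecord F N θ.ν P.K k, ∀ j < k,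
      AxialGauge (cd P j) (Averaging.iter (avOfRecord F N P.K) j (Uk F N P.K k θ.εbg V)))
    (hχregpt : ∀ (P : B12.RunParams) (i : ℕ), i + 1 < P.K → ∀ U : GaugeField (F.P P.K) (i + 1) (SU N),
      (avOfRecord F N P.K (i + 1)).avg U ∈ domAltOfRecord F N θ.ν P.K (i + 2) →
        U ∉ regSetOfRecord F N P.K i (betaInputOfRecord F N (TβOfRecord₁₃ F N) (chiβOfRecord₁₃ F N θ.toStage13Params) P.K (gOfRecord₁₃ F N θ.toStage13Params P) i) ∩
            domAltOfRecord F N θ.ν P.K (i + 1) →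
          chiβOfRecord₁₃ F N θ.toStage13Params P.K (gOfRecord₁₃ F N θ.toStage13Params P) (i + 1) U = 0)
    (hint : ∀ (P : B12.RunParams), ∀ j < P.K, Integrable (betaInputOfRecord F N (TβOfRecord₁₃ F N) (chiβOfRecord₁₃ F N θ.toStage13Params) P.K
      (gOfRecord₁₃ F N θ.toStage13Params P) j) (fieldMeasure (F.P P.K) j (SU N)))
    (h11 : ∀ (P : B12.RunParams) (k : ℕ), k ≤ P.K → ∀ V ∈ domAltOfRecord F N θ.ν P.K k, UkExists F N P.K k θ.εbg V ∧ UniqueUkOrbit F N P.K k θ.εbg V)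
    (hres : ∀ (P : B12.RunParams) (k : ℕ), k ≤ P.K → HRestrict F N θ.εbg P.K k (domAltOfRecord F N θ.ν P.K k))
    (huniq : ∀ (P : B12.RunParams) (k : ℕ), k ≤ P.K → ∀ V ∈ domAltOfRecord F N θ.ν P.K k, ∀ j < k,
      UniqueUkOrbit F N P.K (j + 1) θ.εbg (Averaging.iter (avOfRecord F N P.K) (j + 1) (Uk F N P.K k θ.εbg V)))
    (hεχ : 0 < θ.ε₂₉) (hε : 0 < θ.εbg)
    (hε3 : ∀ P : B12.RunParams, (143 * (((((F.P P.K).d + 4 : ℕ) : ℝ)) ^ 2 / 4) ^ 2) * θ.εbg ≤ 1 / 3)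
    (hε2 : ∀ P : B12.RunParams, 2 * θ.εbg ≤ 2 * deltaSU (Fin N) / ((((F.P P.K).d + 4) * (F.P P.K).L : ℕ) : ℝ) ^ 2)
    (hε₀ : ∀ P : B12.RunParams, 2 * θ.εbg ≤ θ.ν.ε₀ * ((F.P P.K).L : ℝ) ^ 2) :
    ∀ P : B12.RunParams, (leavesP w P).smallCouplings → (leavesP w P).smallFieldInductive :=
  thm3Member_forall_stage13SepCoPH_onDomains_of_axialOn_of_reg8_of_suppPt θ h hC cd
    (fun P => hreg8_of_h11_of_εreg_eq θ.ν θ.εbg P.K hradii (h11 P)) hradii.le (hradii ▸ hε.le) haxDom haxbg hχregpt hint h11 hres huniq hεχ hε hε3 hε2 hε₀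

/-- **v1.2-eq WITH (I19) REPLACED BY (H-U)** (measurability of the level-`(k+1)` minimiser selection at radius `θ.ν.εreg`).  CONDITIONAL; N09 NOT discharged; K1⁹ NOT closed.
[cite: Balaban1987RG1, Thm 3 p.264, (0.19) p.255, (2.1)–(2.3) p.265; Balaban1985Variational, Thm 1 (8) p.279; Balaban1985Averaging, Prop. 2 (53) p.26] -/
theorem thm3Member_forall_stage13SepCoPH_onDomains_of_axialOn_of_suppPt_of_measurableUk_of_radii_eq (θ : Stage13HParams F N) (h : θ.Provisos₁₃SepCoPH F N) {w : WorldP}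
    (hC : w.C = (datumOfRecord₁₃SepCoPH F N θ h).C) (cd : (P : B12.RunParams) → (j : ℕ) → ContourData (F.P P.K) j (SU N))
    (hradii : θ.ν.εreg = θ.εbg)
    (haxDom : ∀ (P : B12.RunParams), ∀ j < P.K, ∀ W ∈ domAltOfRecord F N θ.ν P.K (j + 1), AxialGauge (cd P j) (critCfgOfRecord F N θ.ν P.K j W))
    (haxbg : ∀ (P : B12.RunParams) (k : ℕ), k ≤ P.K → ∀ V ∈ domAltOfRecord F N θ.ν P.K k, ∀ j < k,
      AxialGauge (cd P j) (Averaging.iter (avOfRecord F N P.K) j (Uk F N P.K k θ.εbg V)))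
    (hχregpt : ∀ (P : B12.RunParams) (i : ℕ), i + 1 < P.K → ∀ U : GaugeField (F.P P.K) (i + 1) (SU N),
      (avOfRecord F N P.K (i + 1)).avg U ∈ domAltOfRecord F N θ.ν P.K (i + 2) →
        U ∉ regSetOfRecord F N P.K i (betaInputOfRecord F N (TβOfRecord₁₃ F N) (chiβOfRecord₁₃ F N θ.toStage13Params) P.K (gOfRecord₁₃ F N θ.toStage13Params P) i) ∩
            domAltOfRecord F N θ.ν P.K (i + 1) →
          chiβOfRecord₁₃ F N θ.toStage13Params P.K (gOfRecord₁₃ F N θ.toStage13Params P) (i + 1) U = 0)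
    (hU : ∀ (P : B12.RunParams) (k : ℕ), k < P.K → Measurable (Uk F N P.K (k + 1) θ.ν.εreg))
    (h11 : ∀ (P : B12.RunParams) (k : ℕ), k ≤ P.K → ∀ V ∈ domAltOfRecord F N θ.ν P.K k, UkExists F N P.K k θ.εbg V ∧ UniqueUkOrbit F N P.K k θ.εbg V)
    (hres : ∀ (P : B12.RunParams) (k : ℕ), k ≤ P.K → HRestrict F N θ.εbg P.K k (domAltOfRecord F N θ.ν P.K k))
    (huniq : ∀ (P : B12.RunParams) (k : ℕ), k ≤ P.K → ∀ V ∈ domAltOfRecord F N θ.ν P.K k, ∀ j < k,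
      UniqueUkOrbit F N P.K (j + 1) θ.εbg (Averaging.iter (avOfRecord F N P.K) (j + 1) (Uk F N P.K k θ.εbg V)))
    (hεχ : 0 < θ.ε₂₉) (hε : 0 < θ.εbg)
    (hε3 : ∀ P : B12.RunParams, (143 * (((((F.P P.K).d + 4 : ℕ) : ℝ)) ^ 2 / 4) ^ 2) * θ.εbg ≤ 1 / 3)
    (hε2 : ∀ P : B12.RunParams, 2 * θ.εbg ≤ 2 * deltaSU (Fin N) / ((((F.P P.K).d + 4) * (F.P P.K).L : ℕ) : ℝ) ^ 2)
    (hε₀ : ∀ P : B12.RunParams, 2 * θ.εbg ≤ θ.ν.ε₀ * ((F.P P.K).L : ℝ) ^ 2) :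
    ∀ P : B12.RunParams, (leavesP w P).smallCouplings → (leavesP w P).smallFieldInductive :=
  thm3Member_forall_stage13SepCoPH_onDomains_of_axialOn_of_reg8_of_suppPt_of_measurableUk θ h hC cd
    (fun P => hreg8_of_h11_of_εreg_eq θ.ν θ.εbg P.K hradii (h11 P)) hradii.le (hradii ▸ hε.le) haxDom haxbg hχregpt hU h11 hres huniq hεχ hε hε3 hε2 hε₀

/-- **N09 = `Dag.B12_main` AT EVERY RUN OF A WORLD BOUND TO THE STAGE-13 v1.7 CONSTRUCTION, v1.2-eq**, from N09's own leaf `b12` ([I] Lemma 4) (dag-n09-a `b12_main_of_leaf_of_thm3Member`).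
CONDITIONAL; N09 NOT discharged. [cite: Balaban1987RG1, Lemma 4 (3.53) p.280, Thm 3 p.264 and (2.3) p.265; Balaban1985Variational, Thm 1 (8) p.279] -/
theorem b12_main_forall_stage13SepCoPH_onDomains_of_axialOn_of_suppPt_of_radii_eq (θ : Stage13HParams F N) (h : θ.Provisos₁₃SepCoPH F N) {w : WorldP}
    (hC : w.C = (datumOfRecord₁₃SepCoPH F N θ h).C) (h12 : ∀ P : B12.RunParams, (leavesP w P).b12)
    (cd : (P : B12.RunParams) → (j : ℕ) → ContourData (F.P P.K) j (SU N))
    (hradii : θ.ν.εreg = θ.εbg)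
    (haxDom : ∀ (P : B12.RunParams), ∀ j < P.K, ∀ W ∈ domAltOfRecord F N θ.ν P.K (j + 1), AxialGauge (cd P j) (critCfgOfRecord F N θ.ν P.K j W))
    (haxbg : ∀ (P : B12.RunParams) (k : ℕ), k ≤ P.K → ∀ V ∈ domAltOfRecord F N θ.ν P.K k, ∀ j < k,
      AxialGauge (cd P j) (Averaging.iter (avOfRecord F N P.K) j (Uk F N P.K k θ.εbg V)))
    (hχregpt : ∀ (P : B12.RunParams) (i : ℕ), i + 1 < P.K → ∀ U : GaugeField (F.P P.K) (i + 1) (SU N),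
      (avOfRecord F N P.K (i + 1)).avg U ∈ domAltOfRecord F N θ.ν P.K (i + 2) →
        U ∉ regSetOfRecord F N P.K i (betaInputOfRecord F N (TβOfRecord₁₃ F N) (chiβOfRecord₁₃ F N θ.toStage13Params) P.K (gOfRecord₁₃ F N θ.toStage13Params P) i) ∩
            domAltOfRecord F N θ.ν P.K (i + 1) →
          chiβOfRecord₁₃ F N θ.toStage13Params P.K (gOfRecord₁₃ F N θ.toStage13Params P) (i + 1) U = 0)
    (hint : ∀ (P : B12.RunParams), ∀ j < P.K, Integrable (betaInputOfRecord F N (TβOfRecord₁₃ F N) (chiβOfRecord₁₃ F N θ.toStage13Params) P.K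
      (gOfRecord₁₃ F N θ.toStage13Params P) j) (fieldMeasure (F.P P.K) j (SU N)))
    (h11 : ∀ (P : B12.RunParams) (k : ℕ), k ≤ P.K → ∀ V ∈ domAltOfRecord F N θ.ν P.K k, UkExists F N P.K k θ.εbg V ∧ UniqueUkOrbit F N P.K k θ.εbg V)
    (hres : ∀ (P : B12.RunParams) (k : ℕ), k ≤ P.K → HRestrict F N θ.εbg P.K k (domAltOfRecord F N θ.ν P.K k))
    (huniq : ∀ (P : B12.RunParams) (k : ℕ), k ≤ P.K → ∀ V ∈ domAltOfRecord F N θ.ν P.K k, ∀ j < k,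
      UniqueUkOrbit F N P.K (j + 1) θ.εbg (Averaging.iter (avOfRecord F N P.K) (j + 1) (Uk F N P.K k θ.εbg V)))
    (hεχ : 0 < θ.ε₂₉) (hε : 0 < θ.εbg)
    (hε3 : ∀ P : B12.RunParams, (143 * (((((F.P P.K).d + 4 : ℕ) : ℝ)) ^ 2 / 4) ^ 2) * θ.εbg ≤ 1 / 3)
    (hε2 : ∀ P : B12.RunParams, 2 * θ.εbg ≤ 2 * deltaSU (Fin N) / ((((F.P P.K).d + 4) * (F.P P.K).L : ℕ) : ℝ) ^ 2)
    (hε₀ : ∀ P : B12.RunParams, 2 * θ.εbg ≤ θ.ν.ε₀ * ((F.P P.K).L : ℝ) ^ 2) :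
    ∀ P : B12.RunParams, Dag.B12_main (leavesP w P) :=
  fun P => b12_main_of_leaf_of_thm3Member (h12 P)
    (thm3Member_forall_stage13SepCoPH_onDomains_of_axialOn_of_suppPt_of_radii_eq θ h hC cd hradii haxDom haxbg hχregpt hint h11 hres huniq hεχ hε hε3 hε2 hε₀ P)

/-! ## §3. (S2) Located arithmetic: where FLAG №7′'s substance sits (real inequalities only) -/

/-- **THE INNER∕OUTER INVARIANT (DEF-1 g29's, value-free)**: [B11] Thm 1 (8) applied on a plaquette domain of threshold `δ` gives membership radius `B₃δ` (`hB : B₃·δ ≤ εreg`); with `εreg ≤ εbg`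
and the nesting row `2·εbg ≤ δ·L²` of the on-domains doors this forces `2B₃ ≤ L²` as soon as `0 < δ` — false under print's `B₃ ≥ 2L²` for every value of `(δ, εreg, εbg)`: no PLAQUETTE-keyed
domain is closed under «average the minimiser once».  Pure arithmetic. [cite: Balaban1985Variational, Thm 1 (8) p.279; Balaban1987RG1, (1.2) p.260 and p.259; Balaban1985Averaging, Prop. 2 (53) p.26] -/
theorem two_B₃_le_Lsq_of_rows {L B₃ δ εreg εbg : ℝ} (hB : B₃ * δ ≤ εreg) (hle : εreg ≤ εbg) (hnest : 2 * εbg ≤ δ * L ^ 2) (hδ : 0 < δ) :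
    2 * B₃ ≤ L ^ 2 := by
  nlinarith

/-- The same invariant read as a contradiction with K0's guard `2·L² ≤ B₃` (a consequence of the printed Theorem-1 predicate, `…K0AveragedSingleBondFloor`), for `L > 1`.
[cite: Balaban1985Variational, Thm 1 (8) p.279; Balaban1987RG1, (1.2) p.260 (bookkeeping)] -/
theorem not_plaquetteDomain_rows_of_guard {L B₃ δ εreg εbg : ℝ} (hL : 1 < L) (hguard : 2 * L ^ 2 ≤ B₃) (hδ : 0 < δ) :
    ¬ (B₃ * δ ≤ εreg ∧ εreg ≤ εbg ∧ 2 * εbg ≤ δ * L ^ 2) := by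
  rintro ⟨hB, hle, hnest⟩
  have h := two_B₃_le_Lsq_of_rows hB hle hnest hδ
  nlinarith

/-- ★ **THE ONE-RADIUS OBSTRUCTION**: the once-averaged data `Ū^{k−1}(U_k V)` of an `r`-regular minimiser (`U_k V ∈ bgReg_k(r)`) are `2r∕L²`-regular ([B7] Prop. 2 (53) at NODE 00's averaging,
dag-n21-c `plaqSmall_iter_Uk_level` at `j = k − 1`), so [B11] Thm 1's window of admissible radii for them is `[B₃·(2r∕L²), a₀]`; under `2L² ≤ B₃` and `r = a₀ > 0` (the Z3 pin: the only
regularity displayed for `U_k V` is `εreg = εbg = a₀`) that window is EMPTY — the rows `hres`∕`huniq` of the first averaged level are outside [B11] Thm 1 AS PRINTED, whatever set they are keyed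
on.  Pure arithmetic. [cite: Balaban1985Variational, Thm 1 (6)–(8) p.279 and p.278; Balaban1985Averaging, Prop. 2 (53) p.26; Balaban1987RG1, (2.2)–(2.3) p.265] -/
theorem thm1Window_onceAveraged_empty_at_one_radius {L B₃ a₀ : ℝ} (hL : 0 < L) (hguard : 2 * L ^ 2 ≤ B₃) (ha : 0 < a₀) :
    ¬ ∃ ε₀' : ℝ, B₃ * (2 * a₀ / L ^ 2) ≤ ε₀' ∧ ε₀' ≤ a₀ := by
  rintro ⟨e, h1, h2⟩
  have hL2 : 0 < L ^ 2 := by positivity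
  have h3 : B₃ * (2 * a₀ / L ^ 2) ≤ a₀ := h1.trans h2
  rw [mul_div_assoc', div_le_iff₀ hL2] at h3
  nlinarith [mul_le_mul_of_nonneg_right hguard ha.le]

/-- The general form: the window `[B₃·(2r∕L²), a₀]` is non-empty iff `2·B₃·r ≤ a₀·L²` — print's condition on the MEMBERSHIP radius `r` ([I] p.260 «ε₀ sufficiently small»).
[cite: Balaban1985Variational, Thm 1 (6)–(8) p.279; Balaban1987RG1, (1.2) p.260 and (2.2)–(2.3) p.265] -/
theorem thm1Window_onceAveraged_nonempty_iff {L B₃ a₀ r : ℝ} (hL : 0 < L) :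
    (∃ ε₀' : ℝ, B₃ * (2 * r / L ^ 2) ≤ ε₀' ∧ ε₀' ≤ a₀) ↔ 2 * B₃ * r ≤ a₀ * L ^ 2 := by
  have hL2 : 0 < L ^ 2 := by positivity
  constructor
  · rintro ⟨e, h1, h2⟩
    have h3 : B₃ * (2 * r / L ^ 2) ≤ a₀ := h1.trans h2
    rw [mul_div_assoc', div_le_iff₀ hL2] at h3
    linarith
  · intro h
    refine ⟨a₀, ?_, le_rfl⟩
    rw [mul_div_assoc', div_le_iff₀ hL2]
    linarith

/-- ★ **THE TWO-RADII WINDOW IS INHABITED** (the numeric shape of record for door v1.3): for every `B₃ ≥ 2L²`, `L ≥ 1`, `a₀ > 0`, the choice membership radius `ρ := a₀L²∕(2B₃)`, uniqueness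
radius `εbg := a₀`, outer threshold `ε₀ := a₀∕B₃` satisfies `2·B₃·ρ ≤ a₀·L²` (first-averaged-level window), `ρ ≤ εbg ≤ a₀` ([B11] Thm 1's ceiling), `2·ρ ≤ ε₀·L²` (nesting of the averaged
data into the outer set) and `0 < ε₀ ≤ εbg`.  This is [I]'s regime: the membership radius of `𝔘_k(ε₀)` small against [B11]'s `a₀`. [cite: Balaban1987RG1, (1.2) p.260, p.259 and (2.2)–(2.3) p.265; Balaban1985Variational, Thm 1 p.279] -/
theorem two_radii_window_inhabited {L B₃ a₀ : ℝ} (hL : 1 ≤ L) (hguard : 2 * L ^ 2 ≤ B₃) (ha : 0 < a₀) :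
    ∃ ρ εbg ε₀ : ℝ, 0 < ρ ∧ 2 * B₃ * ρ ≤ a₀ * L ^ 2 ∧ ρ ≤ εbg ∧ εbg ≤ a₀ ∧ 2 * ρ ≤ ε₀ * L ^ 2 ∧ 0 < ε₀ ∧ ε₀ ≤ εbg := by
  have hL2 : 1 ≤ L ^ 2 := one_le_pow₀ hL
  have hB1 : 1 ≤ B₃ := by nlinarith
  have hB0 : 0 < B₃ := by linarith
  refine ⟨a₀ * L ^ 2 / (2 * B₃), a₀, a₀ / B₃, by positivity, ?_, ?_, le_rfl, ?_, by positivity, div_le_self ha.le hB1⟩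
  · rw [mul_div_assoc', div_le_iff₀ (by positivity)]; nlinarith
  · rw [div_le_iff₀ (by positivity)]; nlinarith
  · have h : 2 * (a₀ * L ^ 2 / (2 * B₃)) = a₀ / B₃ * L ^ 2 := by field_simp
    exact h.le

/-- **AT THE Z3 PIN THE SAME `ρ` FITS UNDER THE PINNED LETTERS** (`εreg = εbg = a₀`, `ν.ε₀ = 2a₀∕L²`): `ρ := a₀L²∕(2B₃)` has `2·B₃·ρ ≤ a₀·L²`, `ρ ≤ a₀` (so `ρ ≤ εreg` and `ρ ≤ εbg`) and
`2·ρ ≤ (2a₀∕L²)·L²` — a DOOR-LOCAL membership radius needs no re-pin of the Z3 member (memo §6 (D1′) vs (D2)). [cite: Balaban1987RG1, (1.2) p.260 and p.259; Balaban1985Variational, Thm 1 p.279 (bookkeeping)] -/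
theorem door_local_radius_fits_Z3_pin {L B₃ a₀ : ℝ} (hL : 1 ≤ L) (hguard : 2 * L ^ 2 ≤ B₃) (ha : 0 < a₀) :
    ∃ ρ : ℝ, 0 < ρ ∧ 2 * B₃ * ρ ≤ a₀ * L ^ 2 ∧ ρ ≤ a₀ ∧ 2 * ρ ≤ (2 * a₀ / L ^ 2) * L ^ 2 := by
  have hL2 : 1 ≤ L ^ 2 := one_le_pow₀ hL
  have hB0 : 0 < B₃ := by nlinarith
  have hL20 : (0 : ℝ) < L ^ 2 := by positivity
  refine ⟨a₀ * L ^ 2 / (2 * B₃), by positivity, ?_, ?_, ?_⟩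
  · rw [mul_div_assoc', div_le_iff₀ (by positivity)]; nlinarith
  · rw [div_le_iff₀ (by positivity)]; nlinarith
  · rw [div_mul_cancel₀ _ hL20.ne', mul_div_assoc', div_le_iff₀ (by positivity)]; nlinarith

end Summit.QuantumFields.YangMills.BalabanUVNodes.N09Reg8RowAtEqualRadiiLocated

end
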